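import Mathlib
import HarnessLib
import Summits.HodgeConjecture.Statement
import Summits.HodgeConjecture.HodgeConjecture.Theses.SignSymmetricPowers
import Literature.AlgebraicGeometry.Motives.Sweep1
import Literature.AlgebraicGeometry.Motives.HodgeTensorFactsHolds
import Literature.AlgebraicGeometry.Motives.SmoothHypersurfaceScheme
import Literature.AlgebraicGeometry.Motives.HypersurfaceFormsNonsingular
import Literature.AlgebraicGeometry.Motives.FermatHypersurface
import Literature.AlgebraicGeometry.HodgeTheory.BettiUniverseAxioms
import Literature.AlgebraicGeometry.HodgeTheory.UniversalHypersurfaceDiscriminantExists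
import Literature.AlgebraicGeometry.HodgeTheory.ComplexConjugationHolds
import Literature.AlgebraicGeometry.HodgeTheory.HodgeRiemannPolarizabilityProofs
import Literature.AlgebraicGeometry.HodgeTheory.DiagonalSymmetry
import Literature.AlgebraicGeometry.HodgeTheory.SymmetricHypersurfaceInvolution
import Literature.AlgebraicGeometry.HodgeTheory.HypersurfaceEigenHodgeNumbersJacobian
import Literature.AlgebraicGeometry.HodgeTheory.AlgebraicMonodromyMumfordTate
import Literature.AlgebraicGeometry.HodgeTheory.SymplecticTransvectionGroupDensity
import Literature.AlgebraicGeometry.HodgeTheory.SignSymmetricTransvectionMonodromy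
import Literature.AlgebraicGeometry.HodgeTheory.SignSymmetricCentraliserCommutatorsHodgeGroup
import Literature.AlgebraicGeometry.FundamentalGroup.HypersurfaceComplementMeridians
import Literature.AlgebraicGeometry.HodgeTheory.PicardLefschetzNodalForms
import Literature.AlgebraicGeometry.HodgeTheory.GlobalInvariantCycles
import Literature.AlgebraicGeometry.HodgeTheory.UniversalHypersurfaceDiscriminant
import Literature.AlgebraicGeometry.Motives.MonomialSupportedHypersurfaceSymmetry
import Literature.AlgebraicGeometry.HodgeTheory.BettiUniverseOddCupAlternating
import Literature.AlgebraicGeometry.HodgeTheory.MonomialSupportedHypersurfaceFamilyPoints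
import Literature.AlgebraicGeometry.HodgeTheory.PicardLefschetzSymmetricA3
import Summits.HodgeConjecture.HodgeConjecture.Theorems.SignSymmetricPowersNonsingularAvoidance
import Summits.HodgeConjecture.HodgeConjecture.Theorems.SignSymmetricPowersSignDeckHodge
import Summits.HodgeConjecture.HodgeConjecture.Theorems.SignSymmetricPowersNodalForms
import Summits.HodgeConjecture.HodgeConjecture.Theorems.SignSymmetricPowersSignOrbitData
import Summits.HodgeConjecture.HodgeConjecture.Theorems.SignSymmetricPowersModelTransfer
import Summits.HodgeConjecture.HodgeConjecture.Theorems.SignSymmetricPowersPencilOrbitData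

/-!
# Route `SignSymmetricPowers`, crux K1-B `VeryGeneralSignCommutatorsInHg` (stmt-HodgeConjecture-19716) — CLOSING COMPOSITION

The registered skeleton `line-andre-zariski` v12f (sha16 `276eda50fce4ca90`, HOME/p3/k1line-v12f-g25/) of the rank-1 crux
`Summit.HodgeConjecture.HodgeConjecture.Theses.SignSymmetricPowers.VeryGeneralSignCommutatorsInHg` has every THEOREM stub landed
BY NAME under `Theorems/`: `stub_signNonsingularAvoidance` (p518642), `stub_signDeckHodge` (p526596), `stub_signNodalForms` (p549794),
`stub_signOrbitData` (p541754), `stub_modelTransfer` (p503749), and the five GEO pieces `stub_signFibreCoreC` (p557067),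
`stub_signNoInvariants` (p562551), `stub_signPencilTransvections` (p559818), `stub_signMeridianGeneration` (p574892),
`stub_signConfluenceLinkG` (p574760), assembled into the registered GEO text in `SignSymmetricPowersPencilOrbitData`
(`signPencilOrbitDataF_of_facts`); the binder `stub_discIrreducible` (F-DISC-0, degree-free) is the tree THEOREM
`exists_irreducible_isHomogeneous_discriminantForm` (p566157).  The remaining binders are the nine named Literature FACTS
`voisin2003_finrank_eigenspace_inf_hodgePiece_of_diagonalStabilizer` (Voisin II 6.10/6.12, equivariant),
`affineHypersurfaceComplement_meridians_normalClosure_eq_top` (Zariski–van Kampen), `picardLefschetz_nodalForms_uniform`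
(Picard–Lefschetz for nodal degenerations), `deligne_globalInvariantCycles` (Hodge II 4.1.1), `discriminant_localBranches_nodal`
(local branches of the discriminant at nodal forms), `cmsp_nonHodgeGenericPoints_countable_algebraic_cover` (CMSP: Hodge-generic
points are very general), `deligne_finiteIndex_monodromy_le_mumfordTateGroup` (CMSP 15.3.7 (ii) / André), `picardLefschetz_symmetricA3`
(the symmetric `A₃` confluence), `affineHypersurfaceComplement_meridian_isConj` (meridians of one component are conjugate).
This file is the skeleton's kernel-checked composition `VeryGeneralSignCommutatorsInHg_of` (with its sorry-free seams
`signDeckModel_of_deckHodge`, `signPencilEnvelope_of_orbitData`) with the landed theorems substituted: it proves the crux BY NAME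
modulo those nine registered facts, taken as hypotheses (THE MODEL: an unproved published result is a hypothesis `(h : X)`;
expected closure state `closed modulo ⟨the nine facts⟩`).  No new mathematics: CDK cover ↦ polynomial bad family, nonsingular
avoidance prepended, Hodge genericity off it, `Mon⁰_s ⊆ MT` (15.3.7 (ii)), transport of the `σ`-centraliser to the fibre along `φ`
(COMPAT), the landed `commutator_mem_hodgeGroup_of_signSymmetric` on the fibre, transport back (HG); then the transfer theorem.
-/

set_option linter.dupNamespace false
set_option linter.unusedVariables false
set_option maxHeartbeats 800000

namespace Summit.HodgeConjecture.HodgeConjecture.Theorems.SignSymmetricPowersVeryGeneralSignCommutatorsInHg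

open Literature.AlgebraicGeometry.Motives Literature.AlgebraicGeometry.HodgeTheory
open Literature.AlgebraicGeometry.HodgeTheory.BettiUniverse
open Literature.AlgebraicTopology.SingularHomology
open CategoryTheory

/-- **Seam `SignDeckModel` from the Voisin fact** (port of the skeleton's sorry-free `signDeckModel_of_deckHodge` with the landed
`stub_signDeckHodge` substituted): membership `ha`, `σ*² = 1` and the `tr ∘ cup`-isometry are the Literature theorem
`exists_signDeckModel_clauses_one_two`; the eigen-Hodge numbers are `stub_signDeckHodge hV`. -/
theorem signDeckModel_of_facts (hV : Literature.AlgebraicGeometry.HodgeTheory.voisin2003_finrank_eigenspace_inf_hodgePiece_of_diagonalStabilizer) :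
    open Literature.AlgebraicGeometry.Motives Literature.AlgebraicGeometry.HodgeTheory Literature.AlgebraicGeometry.HodgeTheory.BettiUniverse CategoryTheory.Limits in let pmul2 : List (ℕ × ℕ) → List (ℕ × ℕ) → List (ℕ × ℕ) := fun a b => (List.range (a.length + b.length - 1)).map fun k => (((List.range (k + 1)).map fun i => (a.getD i (0, 0)).1 * (b.getD (k - i) (0, 0)).1 + (a.getD i (0, 0)).2 * (b.getD (k - i) (0, 0)).2).sum, ((List.range (k + 1)).map fun i => (a.getD i (0, 0)).1 * (b.getD (k - i) (0, 0)).2 + (a.getD i (0, 0)).2 * (b.getD (k - i) (0, 0)).1).sum); let fac : ℕ → Bool → List (ℕ × ℕ) := fun d odd => (List.range (d - 1)).map fun k => if odd ∧ ¬ Even k then (0, 1) else (1, 0); let shn : ℕ → ℕ → ℕ → ℕ := fun d j q => if (q + 1) * d < 5 then 0 else if j = 0 then (([fac d true, fac d false, fac d false, fac d false].foldl pmul2 (fac d true)).getD ((q + 1) * d - 5) (0, 0)).1 else (([fac d true, fac d false, fac d false, fac d false].foldl pmul2 (fac d true)).getD ((q + 1) * d - 5) (0, 0)).2; let Deck : (d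 : ℕ) → (X : SchemeOver ℂ) → IsSmoothProjective 3 X → (X ⟶ X) → Prop := fun d X hX σ => pull σ 3 ^ 2 = 1 ∧ (∀ x y, tr hX (3 + 3) (cup X 3 3 (pull σ 3 x) (pull σ 3 y)) = tr hX (3 + 3) (cup X 3 3 x y)) ∧ ∀ j q : ℕ, j < 2 → q ≤ 3 → Module.finrank ℂ ↥(Module.End.eigenspace ((pull σ 3).baseChange ℂ) ((-1 : ℂ) ^ j) ⊓ (hodge exists_isReal_hodgeModel_holds hX 3).piece ((3 : ℤ) - q) q) = shn d j q; let Cen : (X : SchemeOver ℂ) → IsSmoothProjective 3 X → (X ⟶ X) → (bettiCohomology X 3 ≃ₗ[ℚ] bettiCohomology X 3) → Prop := fun X hX σ g => (∀ x, g (pull σ 3 x) = pull σ 3 (g x)) ∧ ∀ x y, tr hX (3 + 3) (cup X 3 3 (g x) (g y)) = tr hX (3 + 3) (cup X 3 3 x y); let Comm : (X : SchemeOver ℂ) → IsSmoothProjective 3 X → (X ⟶ X) → Prop := fun X hX σ => haveI := finite hX 3; haveI : HodgeTensorFacts.{0, 0} := hodgeTensorFacts_holds; ∀ g h : bettiCohomology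 X 3 ≃ₗ[ℚ] bettiCohomology X 3, Cen X hX σ g → Cen X hX σ h → g * h * g⁻¹ * h⁻¹ ∈ (hodge exists_isReal_hodgeModel_holds hX 3).hodgeGroup; ∀ ⦃d : ℕ⦄, Even d → 4 ≤ d → ∀ f : MvPolynomial (Fin 5) ℂ, f.IsHomogeneous d → (∀ e : Fin 5 →₀ ℕ, ¬ Even (e 0 + e 1) → f.coeff e = 0) → SmoothHypersurface.IsNonsingularForm ℂ f → ∀ hXF : IsSmoothProjective 3 (SmoothHypersurface.hypersurface f), ∃ ha : (fun i : Fin 5 => if (i : ℕ) < 2 then (-1 : ℂˣ) else 1) ∈ diagonalStabilizer f, Deck d (SmoothHypersurface.hypersurface f) hXF (diagonalAut f ha) := by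
  intro pmul2 fac shn Deck Cen Comm d hd h4d f hf hev hJ hXF
  obtain ⟨ha, h1, h2⟩ := exists_signDeckModel_clauses_one_two f hev hXF
  refine ⟨ha, ?_⟩
  have h3 := Summit.HodgeConjecture.HodgeConjecture.Theorems.SignSymmetricPowersSignDeckHodge.stub_signDeckHodge hV hd h4d f hf hev hJ hXF ha
  dsimp only [Deck]
  exact ⟨h1, h2, h3⟩

/-- **The sign-pencil ENVELOPE of skeleton v12f from the landed GEO pieces and the landed orbit-data algebra** (port of the
skeleton's sorry-free seam `signPencilEnvelope_of_orbitData`, with `signPencilOrbitDataF_of_facts`, the tree theorem F-DISC-0,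
`stub_signNodalForms` and `stub_signOrbitData` substituted), modulo the six facts GEO consumes. -/
theorem signPencilEnvelope_of_facts (hZvK : Literature.AlgebraicGeometry.FundamentalGroup.affineHypersurfaceComplement_meridians_normalClosure_eq_top)
    (hPL : Literature.AlgebraicGeometry.HodgeTheory.picardLefschetz_nodalForms_uniform) (hGIC : Literature.AlgebraicGeometry.HodgeTheory.deligne_globalInvariantCycles)
    (hD1 : Literature.AlgebraicGeometry.HodgeTheory.discriminant_localBranches_nodal) (hB2 : Literature.AlgebraicGeometry.HodgeTheory.picardLefschetz_symmetricA3)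
    (hMC : Literature.AlgebraicGeometry.FundamentalGroup.affineHypersurfaceComplement_meridian_isConj) :
    open Literature.AlgebraicGeometry.Motives Literature.AlgebraicGeometry.HodgeTheory Literature.AlgebraicGeometry.HodgeTheory.BettiUniverse CategoryTheory.Limits in ∀ ⦃d : ℕ⦄, Even d → 4 ≤ d → ∃ (𝒳 S : SchemeOver ℂ) (u : 𝒳 ⟶ S) (hu : IsSmoothProjectiveFamily u 3) (_ : IsQuasiProjectiveOver S) (_ : AlgebraicGeometry.Smooth S.hom) (_ : IrreducibleSpace S.left) (hU : IsCohomologicallyLocallyTrivialOn u (Set.univ : Set (ComplexPoints S))) (A : ∀ t : ComplexPoints S, HodgeModel 3 (fiberOver u t)) (hA : ∀ t, (A t).IsHodgeSymmetric) (hfin : ∀ t : ComplexPoints S, Module.Finite ℚ (bettiCohomology (fiberOver u t) 3)) (pt : MvPolynomial (Fin 5) ℂ → ComplexPoints S), (∀ W : Set (ComplexPoints S), IsZariskiClosedOnPoints S W → W ≠ Set.univ → ∃ G : MvPolynomial {e : Fin 5 →₀ ℕ // e.degree = d} ℂ, (∃ f : MvPolynomial (Fin 5) ℂ, f.IsHomogeneous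 d ∧ (∀ e : Fin 5 →₀ ℕ, ¬ Even (e 0 + e 1) → f.coeff e = 0) ∧ MvPolynomial.eval (fun e : {e : Fin 5 →₀ ℕ // e.degree = d} => f.coeff e.1) G ≠ 0) ∧ ∀ f : MvPolynomial (Fin 5) ℂ, f.IsHomogeneous d → (∀ e : Fin 5 →₀ ℕ, ¬ Even (e 0 + e 1) → f.coeff e = 0) → IsSmoothProjective 3 (SmoothHypersurface.hypersurface f) → MvPolynomial.eval (fun e : {e : Fin 5 →₀ ℕ // e.degree = d} => f.coeff e.1) G ≠ 0 → pt f ∉ W) ∧ (∀ f : MvPolynomial (Fin 5) ℂ, f.IsHomogeneous d → (∀ e : Fin 5 →₀ ℕ, ¬ Even (e 0 + e 1) → f.coeff e = 0) → SmoothHypersurface.IsNonsingularForm ℂ f → ∀ (hXF : IsSmoothProjective 3 (SmoothHypersurface.hypersurface f)) (ha : (fun i : Fin 5 => if (i : ℕ) < 2 then (-1 : ℂˣ) else 1) ∈ diagonalStabilizer f), ∃ (φ : bettiCohomology (fiberOver u (pt f)) 3 ≃ₗ[ℚ] bettiCohomology (SmoothHypersurface.hypersurface f) 3) (B : LinearMap.BilinForm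 ℚ (bettiCohomology (fiberOver u (pt f)) 3)) (hB : B.IsAlt) (_ : B.Nondegenerate) (τ : bettiCohomology (fiberOver u (pt f)) 3 →ₗ[ℚ] bettiCohomology (fiberOver u (pt f)) 3) (_ : τ ^ 2 = 1) (T D : Set (bettiCohomology (fiberOver u (pt f)) 3)), let Γ := (haveI := hfin (pt f); ratMonodromyGroup u 3 hU ⟨pt f, Set.mem_univ _⟩); let RP : Set (bettiCohomology (fiberOver u (pt f)) 3) := {r ∈ T | τ r = r} ∪ (fun δ => δ + τ δ) '' D; let RN : Set (bettiCohomology (fiberOver u (pt f)) 3) := {r ∈ T | τ r = -r} ∪ (fun δ => δ - τ δ) '' D; Nontrivial (bettiCohomology (fiberOver u (pt f)) 3) ∧ (∀ x y, B (τ x) (τ y) = B x y) ∧ (∀ x, φ (τ x) = pull (diagonalAut f ha) 3 (φ x)) ∧ (∀ x y, B x y = tr hXF (3 + 3) (cup (SmoothHypersurface.hypersurface f) 3 3 (φ x) (φ y))) ∧ (haveI : HodgeTensorFacts.{0, 0} := hodgeTensorFacts_holds; haveI := finite hXF 3; haveI := hfin (pt f); ∀ k : bettiCohomology (fiberOver u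 (pt f)) 3 ≃ₗ[ℚ] bettiCohomology (fiberOver u (pt f)) 3, k ∈ ((A (pt f)).hodgeStructure (hu.isSmoothProjective (pt f)) (hA (pt f)) 3).hodgeGroup → (φ.symm.trans k).trans φ ∈ (hodge exists_isReal_hodgeModel_holds hXF 3).hodgeGroup) ∧ (∀ r ∈ T, ∃ c : ℚ, c ≠ 0 ∧ oneParamTransvectionEquiv B (hB r) c ∈ Γ) ∧ (∀ δ ∈ D, B δ (τ δ) = 0 ∧ ∃ c : ℚ, c ≠ 0 ∧ oneParamTransvectionEquiv B (hB δ) c * oneParamTransvectionEquiv B (hB (τ δ)) c ∈ Γ) ∧ Submodule.span ℚ RP = Module.End.eigenspace τ 1 ∧ (∀ A' ⊆ RP, A'.Nonempty → A' ≠ RP → ∃ r ∈ A', ∃ ρ ∈ RP, ρ ∉ A' ∧ B r ρ ≠ 0) ∧ (RP.Nonempty → ∃ r ∈ T, τ r = r) ∧ Submodule.span ℚ RN = Module.End.eigenspace τ (-1) ∧ (∀ A' ⊆ RN, A'.Nonempty → A' ≠ RN → ∃ r ∈ A', ∃ ρ ∈ RN, ρ ∉ A' ∧ B r ρ ≠ 0)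 ∧ (RN.Nonempty → ∃ r ∈ T, τ r = -r)) := by
  intro d hd h4d
  obtain ⟨𝒳, S, u, hu, hqp, hsm, hirr, hU, A, hA, hfin, pt, hALG, hMEM⟩ := (Summit.HodgeConjecture.HodgeConjecture.Theorems.SignSymmetricPowersPencilOrbitData.signPencilOrbitDataF_of_facts hB2 hMC hZvK hPL hGIC
      (fun n d hd => Literature.AlgebraicGeometry.HodgeTheory.exists_irreducible_isHomogeneous_discriminantForm (n := n) (d := d) hd) hD1
      Summit.HodgeConjecture.HodgeConjecture.Theorems.SignSymmetricPowersNodalForms.stub_signNodalForms) hd h4d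
  refine ⟨𝒳, S, u, hu, hqp, hsm, hirr, hU, A, hA, hfin, pt, hALG, ?_⟩
  intro f hf hev hJ hXF ha
  obtain ⟨φ, B, hB, hBn, τ, hτ, rP, rL, δ₀, c₁, c₂, c₃, E, hNon, hτB, hφτ, hφB, hHG, hΓτ, hΓB, hrP, hrL, hδ₀,
    hc₁, hc₂, hc₃, huP, huL, huδ, hΓE, hE, hinv, hlinkP, hlinkL⟩ := hMEM f hf hev hJ hXF ha
  haveI := hfin (pt f)
  obtain ⟨h6, h7, h8, h9, h10, h11, h12, h13⟩ :=
    Summit.HodgeConjecture.HodgeConjecture.Theorems.SignSymmetricPowersSignOrbitData.stub_signOrbitData _ B hB hBn τ hτ hτB _ hΓτ hΓB rP rL δ₀ c₁ c₂ c₃ E hrP hrL hδ₀ hc₁ hc₂ hc₃ huP huL huδ hΓE hE hinv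
      hlinkP hlinkL
  exact ⟨φ, B, hB, hBn, τ, hτ, _, _, hNon, hτB, hφτ, hφB, hHG, h6, h7, h8, h9, h10, h11, h12, h13⟩

/-- **CLOSING COMPOSITION: the crux `VeryGeneralSignCommutatorsInHg` BY NAME modulo the nine registered named facts** (port of
the skeleton's kernel-checked `VeryGeneralSignCommutatorsInHg_of` with every theorem stub substituted by its landed name).  Proved
here, on the models: CDK cover ↦ polynomial bad family (plus nonsingular avoidance), Hodge genericity off it, `Mon⁰_s ⊆ MT`,
transport of the `σ`-centraliser to the fibre along `φ`, `commutator_mem_hodgeGroup_of_signSymmetric` on the fibre, transport back;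
then the transfer theorem `stub_modelTransfer`. -/
theorem veryGeneralSignCommutatorsInHg_of_facts
    (hV : Literature.AlgebraicGeometry.HodgeTheory.voisin2003_finrank_eigenspace_inf_hodgePiece_of_diagonalStabilizer)
    (hZvK : Literature.AlgebraicGeometry.FundamentalGroup.affineHypersurfaceComplement_meridians_normalClosure_eq_top)
    (hPL : Literature.AlgebraicGeometry.HodgeTheory.picardLefschetz_nodalForms_uniform) (hGIC : Literature.AlgebraicGeometry.HodgeTheory.deligne_globalInvariantCycles)
    (hD1 : Literature.AlgebraicGeometry.HodgeTheory.discriminant_localBranches_nodal)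
    (hCDK : Literature.AlgebraicGeometry.HodgeTheory.cmsp_nonHodgeGenericPoints_countable_algebraic_cover)
    (h1537 : Literature.AlgebraicGeometry.HodgeTheory.deligne_finiteIndex_monodromy_le_mumfordTateGroup)
    (hB2 : Literature.AlgebraicGeometry.HodgeTheory.picardLefschetz_symmetricA3)
    (hMC : Literature.AlgebraicGeometry.FundamentalGroup.affineHypersurfaceComplement_meridian_isConj) :
    Summit.HodgeConjecture.HodgeConjecture.Theses.SignSymmetricPowers.VeryGeneralSignCommutatorsInHg := by
  refine Summit.HodgeConjecture.HodgeConjecture.Theorems.SignSymmetricPowersModelTransfer.stub_modelTransfer ?_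
  intro d hd h4d
  obtain ⟨𝒳, S, u, hu, hqp, hsm, hirr, hU, A, hA, hfin, pt, hALG, hMEM⟩ :=
    signPencilEnvelope_of_facts hZvK hPL hGIC hD1 hB2 hMC hd h4d
  haveI hHTF : HodgeTensorFacts.{0, 0} := hodgeTensorFacts_holds
  haveI : ∀ t : ComplexPoints S, Module.Finite ℚ (bettiCohomology (fiberOver u t) 3) := hfin
  -- the Cattani–Deligne–Kaplan cover of the non-Hodge-generic points of the base
  obtain ⟨W, hW, hcov⟩ := hCDK u 3 3 hu hqp hsm hirr hU A hA
  -- each member of the cover is avoided off one nonzero polynomial condition on the ι-even coefficients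
  choose G hG₀ hG using fun j => hALG (W j) (hW j).1 (hW j).2
  -- v5: prepend the nonsingular-avoidance polynomial `g₀`, so that very general members are NONSINGULAR FORMS (this
  -- excludes the degenerate corners `f = c·G^k`, `k ≥ 2`, where `V₊(f)_red` is a smooth threefold of lower degree)
  obtain ⟨g₀, hg₀, hNSg⟩ := Summit.HodgeConjecture.HodgeConjecture.Theorems.SignSymmetricPowersNonsingularAvoidance.stub_signNonsingularAvoidance hd h4d
  refine ⟨fun i => if i = 0 then g₀ else G (i - 1), ?_, ?_⟩
  · intro i
    by_cases hi : i = 0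
    · simpa only [hi, if_true] using hg₀
    · simpa only [hi, if_false] using hG₀ (i - 1)
  intro f hf hev hgen' hXF ha
  have hJ : SmoothHypersurface.IsNonsingularForm ℂ f := hNSg f hf (by simpa only [if_true] using hgen' 0)
  have hgen : ∀ j, MvPolynomial.eval (fun e : {e : Fin 5 →₀ ℕ // e.degree = d} => f.coeff e.1) (G j) ≠ 0 := fun j => by
    simpa only [Nat.succ_ne_zero, if_false, Nat.add_sub_cancel] using hgen' (j + 1)
  obtain ⟨ha', hdeck⟩ := signDeckModel_of_facts hV hd h4d f hf hev hJ hXF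
  refine ⟨hdeck, ?_⟩
  intro g h hg hh
  obtain ⟨φ, B, hB, hBn, τ, hτ, T, D, hNon, hτB, hφτ, hφB, hHG, hT, hD, hspanPos, hconnPos,
    hseedPos, hspanNeg, hconnNeg, hseedNeg⟩ := hMEM f hf hev hJ hXF ha
  haveI := finite hXF 3
  haveI : Nontrivial (bettiCohomology (fiberOver u (pt f)) 3) := hNon
  -- the classifying point of a very general member is Hodge generic
  have hsgen : IsHodgeGenericPoint u 3 hU hu A hA ⟨pt f, Set.mem_univ _⟩ := by
    by_contra hns
    obtain ⟨j, hj⟩ := hcov ⟨pt f, Set.mem_univ _⟩ hns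
    exact hG j f hf hev hXF (hgen j) hj
  -- CMSP 15.3.7 (ii): the algebraic monodromy group `Mon⁰ = (Γ^Zar)⁰` lies in the Mumford–Tate group of the fibre
  have hΓ : glIdentityComponent (ratMonodromyGroup u 3 hU ⟨pt f, Set.mem_univ _⟩) ⊆
      (((A (pt f)).hodgeStructure (hu.isSmoothProjective (pt f)) (hA (pt f)) 3).mumfordTateGroup : Set (bettiCohomology (fiberOver u (pt f)) 3 ≃ₗ[ℚ] bettiCohomology (fiberOver u (pt f)) 3)) :=
    (h1537 u 3 3 hu hqp hsm hU A hA ⟨pt f, Set.mem_univ _⟩ hsgen).2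
  -- transport the two σ-centraliser isometries to the fibre
  have hστ : ∀ y, τ (φ.symm y) = φ.symm (pull (diagonalAut f ha) 3 y) := fun y => by
    apply φ.injective
    rw [hφτ, LinearEquiv.apply_symm_apply, LinearEquiv.apply_symm_apply]
  have cenτ : ∀ k : bettiCohomology (SmoothHypersurface.hypersurface f) 3 ≃ₗ[ℚ] bettiCohomology (SmoothHypersurface.hypersurface f) 3,
      (∀ x, k (pull (diagonalAut f ha) 3 x) = pull (diagonalAut f ha) 3 (k x)) →
      ∀ x, ((φ.trans k).trans φ.symm) (τ x) = τ (((φ.trans k).trans φ.symm) x) := by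
    intro k hk x
    simp only [LinearEquiv.trans_apply]
    rw [hφτ, hk, hστ]
  have cenB : ∀ k : bettiCohomology (SmoothHypersurface.hypersurface f) 3 ≃ₗ[ℚ] bettiCohomology (SmoothHypersurface.hypersurface f) 3,
      (∀ x y, tr hXF (3 + 3) (cup (SmoothHypersurface.hypersurface f) 3 3 (k x) (k y)) = tr hXF (3 + 3) (cup (SmoothHypersurface.hypersurface f) 3 3 x y)) →
      ∀ x y, B (((φ.trans k).trans φ.symm) x) (((φ.trans k).trans φ.symm) y) = B x y := by
    intro k hk x y
    simp only [LinearEquiv.trans_apply]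
    rw [hφB, LinearEquiv.apply_symm_apply, LinearEquiv.apply_symm_apply, hk, ← hφB]
  -- Theorem A's algebra (landed): commutators of the sign-symmetric centraliser of the fibre lie in its Hodge group
  have hcomm := commutator_mem_hodgeGroup_of_signSymmetric ((A (pt f)).hodgeStructure (hu.isSmoothProjective (pt f)) (hA (pt f)) 3)
    (smoothProjective_hodgeStructure_isPolarizable_holds (hu.isSmoothProjective (pt f)) (A (pt f))
      (hA (pt f)) 3) ⟨1, by norm_num⟩ hB hBn hτ hτB hΓ hT hD hspanPos hconnPos hseedPos hspanNeg hconnNeg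
    hseedNeg (cenτ g hg.1) (cenB g hg.2) (cenτ h hh.1) (cenB h hh.2)
  -- transport back to `H³(X_f;ℚ)` along `φ` (Hodge groups correspond)
  have hback := hHG _ hcomm
  have hid : (φ.symm.trans (((φ.trans g).trans φ.symm) * ((φ.trans h).trans φ.symm) *
      ((φ.trans g).trans φ.symm)⁻¹ * ((φ.trans h).trans φ.symm)⁻¹)).trans φ = g * h * g⁻¹ * h⁻¹ := by
    have hinv : ∀ k : bettiCohomology (SmoothHypersurface.hypersurface f) 3 ≃ₗ[ℚ] bettiCohomology (SmoothHypersurface.hypersurface f) 3,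
        ((φ.trans k).trans φ.symm)⁻¹ = (φ.trans k⁻¹).trans φ.symm := by
      intro k
      rw [inv_eq_iff_mul_eq_one]
      ext x
      simp
    rw [hinv, hinv]
    ext x
    simp
  rw [hid] at hback
  exact hback

end Summit.HodgeConjecture.HodgeConjecture.Theorems.SignSymmetricPowersVeryGeneralSignCommutatorsInHg
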